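import Summits.CriticalPhenomena.CardyFormulaZ2.Theorems.CardyBoundaryCoulombGasHalfPlaneMarkDensityLawNoFreeConstant

/-!
# `HalfPlaneMarkDensityLaw` (crux stmt-CriticalPhenomena-5661), line `Sketch`, wired/dual step:
# stub `stub_jointLimit_selfDualConstraint_of` (W2') — the self-duality constraint on joint limits

Glue.  For a joint subsequential limit `G` of the collinear half-plane crossing function along a
strictly increasing `θ` and `σ, x > 0`, write `K_n(σ,x) = P_{1/2}[(−∞,−⌊σn⌋]×{0} ↔ [1,⌊xn⌋]×{0} in ℤ×ℕ]`
for the wired kernel.  Hypothesis (W1) says that `K_{θ n}(σ,x)` converges, to the limit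
`W_G(σ,x) = lim_M G(−M,−σ,1/M,x)`.  Given the two limits `W₁ = lim_M G(−M,−σ,1/M,x)` and
`W₂ = lim_M G(−M,−x,1/M,σ)`, uniqueness of limits in `ℝ` identifies the (W1)-limits at `(σ,x)` and
`(x,σ)` with `W₁` and `W₂`, so `K_{θ n}(σ,x) + K_{θ n}(x,σ) → W₁ + W₂`; the duality–reflection law
`K_n(σ,x) + K_n(x,σ) → 1` (`SelfDual.selfDualReflection`, stmt-CriticalPhenomena-9327) run along `θ`
gives `W₁ + W₂ = 1`.
-/

noncomputable section

namespace Summit.CriticalPhenomena.CardyFormulaZ2.Cruxes.HalfPlaneMarkDensityLaw.SketchLine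

open Literature.Probability.Percolation Literature.Probability.LatticeModels
open MeasureTheory Filter Set
open scoped Topology
open Summit.CriticalPhenomena.CardyFormulaZ2.Theorems.HalfPlaneMarkDensityLaw.Negative

namespace WiredDual

/-- STUB W2' (glue): W1 and `SelfDual.selfDualReflection` give W2 — **`W_G(σ,x) + W_G(x,σ) = 1`**
for every joint subsequential limit `G`: the (W1)-limits of the wired kernels `K_{θ n}(σ,x)`,
`K_{θ n}(x,σ)` are `W₁`, `W₂` by uniqueness of limits, their sum tends to `W₁ + W₂`, and the
duality–reflection law along `θ` says it tends to `1`. [folklore] -/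
theorem stub_jointLimit_selfDualConstraint_of :
    (∀ {θ : ℕ → ℕ} {G : ℝ → ℝ → ℝ → ℝ → ℝ},
      (∀ a b c y : ℝ, a < b → b < c → c < y →
        Tendsto (fun n ↦ μ.real (openCrossing halfPlane (arcA a b (θ n))
          (rowIcc ⌊c * (θ n : ℕ)⌋ ⌊y * (θ n : ℕ)⌋))) atTop (𝓝 (G a b c y))) →
      StrictMono θ → ∀ σ x : ℝ, 0 < σ → 0 < x → ∃ W : ℝ,
        Tendsto (fun M : ℕ ↦ G (-(M : ℝ)) (-σ) ((M : ℝ)⁻¹) x) atTop (𝓝 W) ∧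
        Tendsto (fun n ↦ μ.real (openCrossing halfPlane {v : Site 2 | v 1 = 0 ∧ v 0 ≤ -⌊σ * (θ n : ℕ)⌋} {v : Site 2 | v 1 = 0 ∧ 1 ≤ v 0 ∧ v 0 ≤ ⌊x * (θ n : ℕ)⌋})) atTop (𝓝 W)) →
    ∀ {θ : ℕ → ℕ} {G : ℝ → ℝ → ℝ → ℝ → ℝ},
      (∀ a b c y : ℝ, a < b → b < c → c < y →
        Tendsto (fun n ↦ μ.real (openCrossing halfPlane (arcA a b (θ n))
          (rowIcc ⌊c * (θ n : ℕ)⌋ ⌊y * (θ n : ℕ)⌋))) atTop (𝓝 (G a b c y))) →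
      StrictMono θ → ∀ σ x : ℝ, 0 < σ → 0 < x → ∀ W₁ W₂ : ℝ,
        Tendsto (fun M : ℕ ↦ G (-(M : ℝ)) (-σ) ((M : ℝ)⁻¹) x) atTop (𝓝 W₁) →
        Tendsto (fun M : ℕ ↦ G (-(M : ℝ)) (-x) ((M : ℝ)⁻¹) σ) atTop (𝓝 W₂) → W₁ + W₂ = 1 := by
  intro hW1 θ G hG hθ σ x hσ hx W₁ W₂ h₁ h₂
  -- (W1) at `(σ, x)`: the wired kernel `K_{θ n}(σ,x)` tends to `W₁`
  obtain ⟨W, hW, hK⟩ := hW1 hG hθ σ x hσ hx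
  have e₁ : W = W₁ := tendsto_nhds_unique hW h₁
  subst e₁
  -- (W1) at `(x, σ)`: the wired kernel `K_{θ n}(x,σ)` tends to `W₂`
  obtain ⟨W', hW', hK'⟩ := hW1 hG hθ x σ hx hσ
  have e₂ : W' = W₂ := tendsto_nhds_unique hW' h₂
  subst e₂
  -- the duality–reflection law `K_n(σ,x) + K_n(x,σ) → 1`, along `θ`
  have hsd := (SelfDual.selfDualReflection σ x hσ hx).comp hθ.tendsto_atTop
  -- the sum of the two wired kernels along `θ` tends to `W + W'`
  have hsum := hK.add hK'
  exact (tendsto_nhds_unique hsd hsum).symm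

end WiredDual

end Summit.CriticalPhenomena.CardyFormulaZ2.Cruxes.HalfPlaneMarkDensityLaw.SketchLine
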